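import Summits.RiemannHypothesis.RiemannHypothesis.Theorems.OddSectorOddBartaFloorThetaNull
import Summits.RiemannHypothesis.RiemannHypothesis.Theorems.OddSectorOddBartaFloorTailPolar
import Summits.RiemannHypothesis.RiemannHypothesis.Theorems.OddSectorOddBartaFloorTailPrime
import Summits.RiemannHypothesis.RiemannHypothesis.Theorems.OddSectorOddBartaFloorTailArchBombieri
import Summits.RiemannHypothesis.RiemannHypothesis.Theorems.OddSectorOddBartaFloorTailArchFubini
import Summits.RiemannHypothesis.RiemannHypothesis.Theorems.OddSectorOddBartaFloorTailUniform
import Summits.RiemannHypothesis.RiemannHypothesis.Theorems.OddSectorOddBartaFloorImageMemLp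
import Literature.NumberTheory.LFunctions.WeilWindowSimpleEven
import HarnessLib

/-!
# Crux `OddSector.OddBartaFloor`, line `Sketch`: the transport identity `W(g ⋆ H̃_a) = ∫ g T_a`

Assembly lemma `stub_asmTransport` of the lead's skeleton (crux item stmt-RiemannHypothesis-17779,
route `RiemannHypothesis/OddSector`). For a window test `g` (`tsupport g ⊆ [−a, a]`, `a > 0`) the
polarised Weil functional against the BV odd theta probe `H_a = weilOddThetaVector a` equals the
`L²`-pairing of `g` with the WINDOW IMAGE `T_a = oddThetaImage a`:

* for every `b ≥ a`, `H_a = H_b − R_{a,b}` (`R_{a,b} = oddThetaTailTrunc a b`), so by linearity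
  `W(g ⋆ H̃_a) = W(g ⋆ H̃_b) − W(g ⋆ R̃_{a,b})`, and the window computation of the landed stubs
  (`stub_tailPolar`, `stub_tailPrime`, `stub_tailArchBombieri`, `stub_tailArchFubini`) gives
  `W(g ⋆ R̃_{a,b}) = −∫ g T_{a,b}`;
* `W(g ⋆ H̃_b) → 0` as `b → ∞` (`stub_thetaNull`: `Φ′` is a null vector of Weil's form) and
  `∫ g T_{a,b} → ∫ g T_a` (`stub_tailUniform`, with `g·T_a` integrable by `stub_imageMemLp`).
-/

set_option linter.dupNamespace false

noncomputable section

open Set MeasureTheory Filter Complex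
open scoped Real Topology ComplexConjugate ArithmeticFunction.vonMangoldt ENNReal

namespace Summit.RiemannHypothesis.RiemannHypothesis.Theorems.OddBartaFloor

open Literature.NumberTheory.LFunctions

/-! ## Kernels against bounded compactly supported probes -/

/-- A continuous function supported in `[−a, a]` vanishes off the OPEN window (its support is open
and contained in the interior `(−a, a)`). -/
theorem eq_zero_of_notMem_Ioo {g : ℝ → ℂ} (hg : Continuous g) {a : ℝ}
    (hga : tsupport g ⊆ Icc (-a) a) {t : ℝ} (ht : t ∉ Ioo (-a) a) : g t = 0 := by
  have hopen : IsOpen (Function.support g) := hg.isOpen_support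
  have hsub : Function.support g ⊆ interior (Icc (-a) a) :=
    interior_maximal ((subset_tsupport g).trans hga) hopen
  rw [interior_Icc] at hsub
  by_contra h
  exact ht (hsub (Function.mem_support.2 h))

/-- Integrability of the convolution integrand `u ↦ g(u) F(t − u)` for `g` continuous with compact
support and `F` bounded and measurable. -/
theorem integrable_mul_comp_sub {g F : ℝ → ℂ} (hg : Continuous g) (hgc : HasCompactSupport g)
    (hF : Measurable F) {B : ℝ} (hB : ∀ t, ‖F t‖ ≤ B) (t : ℝ) :
    Integrable fun u => g u * F (t - u) := by
  exact (hg.integrable_of_hasCompactSupport hgc).mul_bdd (c := B)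
    ((hF.comp (measurable_const.sub measurable_id)).aestronglyMeasurable)
    (Eventually.of_forall fun u => hB _)

/-- Linearity of `weilConv g ·` on bounded measurable probes (pointwise `integral_sub`). -/
theorem weilConv_sub_right {g F₁ F₂ : ℝ → ℂ} (hg : Continuous g) (hgc : HasCompactSupport g)
    (hF₁ : Measurable F₁) (hF₂ : Measurable F₂) {B : ℝ} (hB₁ : ∀ t, ‖F₁ t‖ ≤ B) (hB₂ : ∀ t, ‖F₂ t‖ ≤ B) :
    weilConv g (fun t => F₁ t - F₂ t) = fun t => weilConv g F₁ t - weilConv g F₂ t := by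
  funext t
  rw [weilConv_apply, weilConv_apply, weilConv_apply,
    ← integral_sub (integrable_mul_comp_sub hg hgc hF₁ hB₁ t) (integrable_mul_comp_sub hg hgc hF₂ hB₂ t)]
  congr 1 with u
  ring

/-- The complexified odd theta vector `t ↦ (H_c(t) : ℂ)` is measurable. -/
theorem measurable_thetaC (c : ℝ) : Measurable fun t => ((weilOddThetaVector c t : ℝ) : ℂ) :=
  Complex.measurable_ofReal.comp (measurable_weilOddThetaVector c)

/-- The reflected complexified theta vector is `t ↦ H_c(−t)` (`H_c` is real). -/
theorem weilReflect_thetaC (c : ℝ) :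
    weilReflect (fun t => ((weilOddThetaVector c t : ℝ) : ℂ)) =
      fun t => ((weilOddThetaVector c (-t) : ℝ) : ℂ) := by
  funext t
  simp only [weilReflect, conj_ofReal]

/-- `g ⋆ H̃_c` is a Weil test for every Weil test `g`. -/
theorem isWeilTest_weilConv_thetaC {g : ℝ → ℂ} (hg : IsWeilTest g) (c : ℝ) :
    IsWeilTest (weilConv g (weilReflect fun t => ((weilOddThetaVector c t : ℝ) : ℂ))) := by
  have hPi : Integrable (weilReflect fun t => ((weilOddThetaVector c t : ℝ) : ℂ)) := by
    rw [weilReflect_thetaC]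
    exact ((integrable_weilOddThetaVector c).ofReal (𝕜 := ℂ)).comp_neg
  have hPc : HasCompactSupport (weilReflect fun t => ((weilOddThetaVector c t : ℝ) : ℂ)) := by
    rw [weilReflect_thetaC]
    refine HasCompactSupport.intro isCompact_Icc (K := Icc (-c) c) fun t ht => ?_
    rw [weilOddThetaVector_of_not_mem fun h => ht (neg_mem_Icc_neg_iff.1 h), ofReal_zero]
  rw [weilConv_eq_convolution_real]
  exact ⟨hg.2.contDiff_convolution_left (ContinuousLinearMap.mul ℝ ℂ) hg.1 hPi.locallyIntegrable,
    HasCompactSupport.convolution (L := ContinuousLinearMap.mul ℝ ℂ) hg.2 hPc⟩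

/-! ## The transport identity -/

/-- **`W(g ⋆ H̃_a) = W(g ⋆ H̃_b) + ∫ g T_{a,b}` for `0 < a ≤ b`**: linearity of the polarised
functional in the probe (`H_a = H_b − R_{a,b}`) and the window computation
`W(g ⋆ R̃_{a,b}) = −∫ g T_{a,b}` (polar − prime + arch, landed stubs). -/
theorem weilFunctional_thetaC_eq_add_trunc {a b : ℝ} {g : ℝ → ℂ} (ha : 0 < a) (hab : a ≤ b)
    (hg : IsWeilTest g) (hga : tsupport g ⊆ Icc (-a) a) :
    weilFunctional (weilConv g (weilReflect fun t => ((weilOddThetaVector a t : ℝ) : ℂ))) =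
      weilFunctional (weilConv g (weilReflect fun t => ((weilOddThetaVector b t : ℝ) : ℂ))) +
        ∫ t, g t * ((oddThetaImageTrunc a b t : ℝ) : ℂ) := by
  -- bounds and measurability of the probes
  obtain ⟨Ba, hBa0, hBa⟩ := exists_abs_weilOddThetaVector_le a
  obtain ⟨Bb, hBb0, hBb⟩ := exists_abs_weilOddThetaVector_le b
  set B : ℝ := Ba + Bb with hB
  have hHb : ∀ t, ‖weilReflect (fun t => ((weilOddThetaVector b t : ℝ) : ℂ)) t‖ ≤ B := fun t => by
    rw [weilReflect_thetaC]; simp only [norm_real, Real.norm_eq_abs]; linarith [hBb (-t), hBa0]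
  have hRb : ∀ t, ‖weilReflect (fun t => ((oddThetaTailTrunc a b t : ℝ) : ℂ)) t‖ ≤ B := fun t => by
    simp only [weilReflect, conj_ofReal, norm_real, Real.norm_eq_abs, oddThetaTailTrunc_def]
    exact (abs_sub _ _).trans (by linarith [hBb (-t), hBa (-t)])
  have hmH : Measurable (weilReflect fun t => ((weilOddThetaVector b t : ℝ) : ℂ)) := by
    rw [weilReflect_thetaC]; exact (measurable_thetaC b).comp measurable_neg
  have hmR : Measurable (weilReflect fun t => ((oddThetaTailTrunc a b t : ℝ) : ℂ)) := by
    have : weilReflect (fun t => ((oddThetaTailTrunc a b t : ℝ) : ℂ)) =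
        fun t => ((weilOddThetaVector b (-t) : ℝ) : ℂ) - ((weilOddThetaVector a (-t) : ℝ) : ℂ) := by
      funext t; simp only [weilReflect, oddThetaTailTrunc_def, ofReal_sub, map_sub, conj_ofReal]
    rw [this]
    exact ((measurable_thetaC b).comp measurable_neg).sub ((measurable_thetaC a).comp measurable_neg)
  -- `H̃_a = H̃_b − R̃_{a,b}` and linearity of the convolution
  have hsplit : weilReflect (fun t => ((weilOddThetaVector a t : ℝ) : ℂ)) = fun t =>
      weilReflect (fun t => ((weilOddThetaVector b t : ℝ) : ℂ)) t -
        weilReflect (fun t => ((oddThetaTailTrunc a b t : ℝ) : ℂ)) t := by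
    funext t
    simp only [weilReflect, oddThetaTailTrunc_def, ofReal_sub, map_sub, conj_ofReal]
    ring
  have hconv : weilConv g (weilReflect fun t => ((weilOddThetaVector a t : ℝ) : ℂ)) = fun t =>
      weilConv g (weilReflect fun t => ((weilOddThetaVector b t : ℝ) : ℂ)) t -
        weilConv g (weilReflect fun t => ((oddThetaTailTrunc a b t : ℝ) : ℂ)) t := by
    rw [hsplit]
    exact weilConv_sub_right hg.1.continuous hg.2 hmH hmR hHb hRb
  -- both kernels are Weil tests
  have hkH : IsWeilTest (weilConv g (weilReflect fun t => ((weilOddThetaVector b t : ℝ) : ℂ))) :=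
    isWeilTest_weilConv_thetaC hg b
  have hkR : IsWeilTest (weilConv g (weilReflect fun t => ((oddThetaTailTrunc a b t : ℝ) : ℂ))) := by
    have h1 := isWeilTest_weilConv_thetaC hg b
    have h2 := isWeilTest_weilConv_thetaC hg a
    have heq : weilConv g (weilReflect fun t => ((oddThetaTailTrunc a b t : ℝ) : ℂ)) = fun t =>
        weilConv g (weilReflect fun t => ((weilOddThetaVector b t : ℝ) : ℂ)) t -
          weilConv g (weilReflect fun t => ((weilOddThetaVector a t : ℝ) : ℂ)) t := by
      have hs : weilReflect (fun t => ((oddThetaTailTrunc a b t : ℝ) : ℂ)) = fun t =>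
          weilReflect (fun t => ((weilOddThetaVector b t : ℝ) : ℂ)) t -
            weilReflect (fun t => ((weilOddThetaVector a t : ℝ) : ℂ)) t := by
        funext t
        simp only [weilReflect, oddThetaTailTrunc_def, ofReal_sub, map_sub, conj_ofReal]
      have hmHa : Measurable (weilReflect fun t => ((weilOddThetaVector a t : ℝ) : ℂ)) := by
        rw [weilReflect_thetaC]; exact (measurable_thetaC a).comp measurable_neg
      have hHa : ∀ t, ‖weilReflect (fun t => ((weilOddThetaVector a t : ℝ) : ℂ)) t‖ ≤ B := fun t => by
        rw [weilReflect_thetaC]; simp only [norm_real, Real.norm_eq_abs]; linarith [hBa (-t), hBb0]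
      rw [hs]
      exact weilConv_sub_right hg.1.continuous hg.2 hmH hmHa hHb hHa
    rw [heq]
    exact ⟨h1.1.sub h2.1, h1.2.sub h2.2⟩
  -- linearity of `W`
  have hW : weilFunctional (weilConv g (weilReflect fun t => ((weilOddThetaVector a t : ℝ) : ℂ))) =
      weilFunctional (weilConv g (weilReflect fun t => ((weilOddThetaVector b t : ℝ) : ℂ))) -
        weilFunctional (weilConv g (weilReflect fun t => ((oddThetaTailTrunc a b t : ℝ) : ℂ))) := by
    rw [hconv]
    have hneg : (fun t => weilConv g (weilReflect fun t => ((weilOddThetaVector b t : ℝ) : ℂ)) t -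
        weilConv g (weilReflect fun t => ((oddThetaTailTrunc a b t : ℝ) : ℂ)) t) =
        weilConv g (weilReflect fun t => ((weilOddThetaVector b t : ℝ) : ℂ)) +
          fun t => (-1 : ℂ) * weilConv g (weilReflect fun t => ((oddThetaTailTrunc a b t : ℝ) : ℂ)) t := by
      funext t; simp only [Pi.add_apply]; ring
    rw [hneg, weilFunctional_add hkH (hkR.const_mul (-1)), weilFunctional_const_mul]
    ring
  -- the window computation
  have hpol := stub_tailPolar a b g ha hab hg hga
  obtain ⟨hPi, hpr⟩ := stub_tailPrime a b g ha hab hg hga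
  have harB := stub_tailArchBombieri a b g ha hab hg hga
  obtain ⟨hAi, harF⟩ := stub_tailArchFubini a b g ha hab hg hga
  have hsinh : Integrable fun t => g t * (Real.sinh (t / 2) : ℂ) :=
    ((hg.1.continuous.mul (by fun_prop)).integrable_of_hasCompactSupport hg.2.mul_right)
  set c : ℂ := 2 * (oddThetaPolarWeightTrunc a b : ℂ) with hc
  have h1i : Integrable fun t => c * (g t * (Real.sinh (t / 2) : ℂ)) := hsinh.const_mul c
  have h12 : Integrable fun t => c * (g t * (Real.sinh (t / 2) : ℂ)) +
      g t * ((oddThetaPrimeLayerTrunc a b t : ℝ) : ℂ) := h1i.add hPi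
  have hT : ∫ t, g t * ((oddThetaImageTrunc a b t : ℝ) : ℂ) =
      c * (∫ t, g t * (Real.sinh (t / 2) : ℂ)) +
        (∫ t, g t * ((oddThetaPrimeLayerTrunc a b t : ℝ) : ℂ)) +
        ∫ t, g t * ((oddThetaArchLayerTrunc a b t : ℝ) : ℂ) := by
    have e : (fun t => g t * ((oddThetaImageTrunc a b t : ℝ) : ℂ)) = fun t =>
        (c * (g t * (Real.sinh (t / 2) : ℂ)) + g t * ((oddThetaPrimeLayerTrunc a b t : ℝ) : ℂ)) +
          g t * ((oddThetaArchLayerTrunc a b t : ℝ) : ℂ) := by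
      funext t
      simp only [oddThetaImageTrunc_def, hc]
      push_cast
      ring
    rw [e, integral_add h12 hAi, integral_add h1i hPi, integral_const_mul]
  have hWR : weilFunctional (weilConv g (weilReflect fun t => ((oddThetaTailTrunc a b t : ℝ) : ℂ))) =
      -∫ t, g t * ((oddThetaImageTrunc a b t : ℝ) : ℂ) := by
    rw [weilFunctional, hpol, hpr, harB, harF, hT, hc]
    ring
  rw [hW, hWR]
  ring

/-- **The transport identity** (assembly lemma `stub_asmTransport` of the skeleton): for a window
test `g` on `[−a, a]`, `a > 0`, `W(g ⋆ H̃_a) = ∫ g(t) T_a(t) dt`. Let `b → ∞` in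
`W(g ⋆ H̃_a) = W(g ⋆ H̃_b) + ∫ g T_{a,b}`: the first term tends to `0` (null identity) and the
second to `∫ g T_a` (uniform convergence `T_{a,b} → T_a` on the open window, where `g` lives;
`g·T_a` is integrable because `g ∈ L²` and `𝟙_{(−a,a)}T_a ∈ L²`). -/
theorem stub_asmTransport :
    ∀ (a : ℝ) (g : ℝ → ℂ), 0 < a → IsWeilTest g → tsupport g ⊆ Icc (-a) a →
      weilFunctional (weilConv g (weilReflect fun t => ((weilOddThetaVector a t : ℝ) : ℂ))) =
        ∫ t, g t * ((oddThetaImage a t : ℝ) : ℂ) := by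
  intro a g ha hg hga
  set L : ℂ := weilFunctional (weilConv g (weilReflect fun t => ((weilOddThetaVector a t : ℝ) : ℂ))) with hL
  set I : ℂ := ∫ t, g t * ((oddThetaImage a t : ℝ) : ℂ) with hI
  -- integrability of `g · T_a` (through the square-integrable truncation to the open window)
  set T : ℝ → ℝ := (Ioo (-a) a).indicator (oddThetaImage a) with hTdef
  have hgT : ∀ t, g t * ((oddThetaImage a t : ℝ) : ℂ) = g t * ((T t : ℝ) : ℂ) := fun t => by
    by_cases ht : t ∈ Ioo (-a) a
    · simp [hTdef, indicator_of_mem ht]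
    · simp [eq_zero_of_notMem_Ioo hg.1.continuous hga ht]
  have hTm : MemLp (fun t => ((T t : ℝ) : ℂ)) 2 volume := (stub_imageMemLp a ha).ofReal
  have hIi : Integrable fun t => g t * ((oddThetaImage a t : ℝ) : ℂ) := by
    have h := hg.memLp_two.integrable_mul hTm
    exact h.congr (Eventually.of_forall fun t => by simp [hgT t])
  -- the two limits
  have hnull := stub_thetaNull g hg
  have hunif : Tendsto (fun b : ℝ => ∫ t, g t * ((oddThetaImageTrunc a b t : ℝ) : ℂ)) atTop (𝓝 I) := by
    rw [Metric.tendsto_atTop]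
    intro ε hε
    have hgi : Integrable g := hg.1.continuous.integrable_of_hasCompactSupport hg.2
    set M : ℝ := ∫ t, ‖g t‖ with hM
    have hM0 : 0 ≤ M := integral_nonneg fun _ => norm_nonneg _
    obtain ⟨b₀, hb₀⟩ := stub_tailUniform a ha (ε / (2 * (M + 1))) (by positivity)
    refine ⟨max b₀ a, fun b hb => ?_⟩
    have hb₀b : b₀ ≤ b := le_trans (le_max_left _ _) hb
    have hab : a ≤ b := le_trans (le_max_right _ _) hb
    obtain ⟨hPi, -⟩ := stub_tailPrime a b g ha hab hg hga
    obtain ⟨hAi, -⟩ := stub_tailArchFubini a b g ha hab hg hga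
    have hsinh : Integrable fun t => g t * (Real.sinh (t / 2) : ℂ) :=
      ((hg.1.continuous.mul (by fun_prop)).integrable_of_hasCompactSupport hg.2.mul_right)
    have hIbi : Integrable fun t => g t * ((oddThetaImageTrunc a b t : ℝ) : ℂ) := by
      have h := ((hsinh.const_mul (2 * (oddThetaPolarWeightTrunc a b : ℂ))).add hPi).add hAi
      refine h.congr (Eventually.of_forall fun t => ?_)
      simp only [Pi.add_apply, oddThetaImageTrunc_def]
      push_cast
      ring
    rw [dist_eq_norm, ← integral_sub hIbi hIi]
    have hpt : ∀ t, ‖g t * ((oddThetaImageTrunc a b t : ℝ) : ℂ) - g t * ((oddThetaImage a t : ℝ) : ℂ)‖ ≤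
        ε / (2 * (M + 1)) * ‖g t‖ := fun t => by
      by_cases ht : t ∈ Ioo (-a) a
      · rw [← mul_sub, norm_mul, ← ofReal_sub, norm_real, Real.norm_eq_abs, mul_comm]
        exact mul_le_mul_of_nonneg_right (hb₀ b hb₀b t ht) (norm_nonneg _)
      · rw [eq_zero_of_notMem_Ioo hg.1.continuous hga ht]
        simp only [zero_mul, sub_zero, norm_zero, mul_zero, le_refl]
    calc ‖∫ t, (g t * ((oddThetaImageTrunc a b t : ℝ) : ℂ) - g t * ((oddThetaImage a t : ℝ) : ℂ))‖
        ≤ ∫ t, ε / (2 * (M + 1)) * ‖g t‖ :=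
          norm_integral_le_of_norm_le (hgi.norm.const_mul _) (Eventually.of_forall hpt)
      _ = ε / (2 * (M + 1)) * M := by rw [integral_const_mul]
      _ < ε := by
          rw [div_mul_eq_mul_div, div_lt_iff₀ (by positivity)]
          nlinarith
  -- conclude by uniqueness of limits along `b → ∞`
  have hconst : Tendsto (fun _ : ℝ => L) atTop (𝓝 (0 + I)) := by
    have hsum := hnull.add hunif
    refine hsum.congr' ?_
    filter_upwards [eventually_ge_atTop a] with b hab
    exact (weilFunctional_thetaC_eq_add_trunc ha hab hg hga).symm
  have := tendsto_nhds_unique (tendsto_const_nhds (x := L)) hconst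
  rw [this, zero_add]

end Summit.RiemannHypothesis.RiemannHypothesis.Theorems.OddBartaFloor

end
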